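import Literature.AlgebraicGeometry.Frobenioids.Prop55Sub
import Literature.AlgebraicGeometry.Frobenioids.UnitTrivializationStandardTypeProofs
import Literature.AlgebraicGeometry.Frobenioids.UnitTrivialModelType
import Literature.AlgebraicGeometry.Frobenioids.UnitTrivializationBiratSubgroup
import Literature.AlgebraicGeometry.Frobenioids.UnitTrivializationBiratCompactUp
import Literature.AlgebraicGeometry.Frobenioids.UnitTrivializationPullbacks
import Literature.AlgebraicGeometry.Frobenioids.IsometricPreSteps
import Literature.AlgebraicGeometry.Frobenioids.EquivalenceUnitsTransport
import HarnessLib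

/-!
# Frobenioids I, Proposition 5.5 (iii), "Finally" (RATIONALLY STANDARD type) — the `C^un-tr` conjunct,
# PROVED at THE constructions

Mochizuki, *The geometry of Frobenioids I: the general theory*, Kyushu J. Math. **62** (2008)
293–400, §5, Proposition 5.5 (iii) p. 104 ll. 37–39: "Finally, suppose further that `C` is not of
group-like type. Then if `C` is of standard (respectively, rationally standard) type, then so are
`C^un-tr`, `C^rlf`"; proof p. 105 ll. 20–27 ("`(C^un-tr)^birat` admits a Frobenius-compact object … it
follows immediately from the definitions"); Def. 4.5 (iii) p. 86 (rationally standard type =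
(a) birationally Frobenius-normalized, rational and standard type, (b) `(C^un-tr)^birat` admits a
Frobenius-compact object). [cite: MochizukiFrdI2008, Prop. 5.5 (iii) p.104]

PROOF-ONLY companion (cell abc-iut, sub-DAG S7 row `FrdI:Prop5.5(iii)/P55-L07` ratStd half, seat
abc-iut-w5-d250) of the statements file `Prop55Sub.lean` (seat abc-iut-w4-d084). It closes the
**`C^un-tr` conjunct** of `FrdI.Prop55Sub.Prop55iii_untr_rlf_ratStd` UNCONDITIONALLY, over THE parameters
`rsParams` (THE birationalizations, the support predicate `Supp` of `Φ` shared by `C → F_Φ` and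
`C^un-tr → F_Φ`), clause by clause of Def. 4.5 (iii):
* (a) standard type — seat abc-iut-w4-d084's `isOfStandardType_untr'`;
* (a) birationally Frobenius-normalized type — `C^un-tr` is a Frobenioid of isotropic and unit-trivial
  type, hence of model type at THE birationalization (Thm. 5.1 (iv), seat abc-iut-w4-d108's
  `isOfBiratFrobeniusNormalizedType_biratData_of_isOfUnitTrivialType`);
* (a) rational type — `isRational_untr_of`: a rational object of `C` lying in `C^istr` is rational in
  `C^un-tr`: the strictly rational pull-back source `A′ → A` is isotropic (Prop. 1.9 (iv)), its class is a
  pull-back morphism of `C^un-tr` (seat abc-iut-L1-d5), and the witnessing rational functions lie in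
  `Φ^birat_{C^un-tr} ⊇ Φ^birat_C` (`biratSubgroup_le_untr`, this seat);
* (b) a Frobenius-compact object of `((C^un-tr)^un-tr)^birat` from the given one of `(C^un-tr)^birat`
  (`Birat.exists_isFrobeniusCompact_untrBirat_of`, this seat, applied to the Frobenioid `C^un-tr`, which
  is of isotropic and unit-trivial type).
Main theorem: `FrdI.Prop55Sub.prop55iii_untr_ratStd_of`. The `C^rlf` conjunct of the named slot is NOT
closable as typed (its support predicate `SuppR` on `Φ^rlf` is a free binder: GAP row P55iii-F1, L1-lead
R85 (3)); its repaired successor is typed separately. No statement of the paper is strengthened (the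
printed standing hypotheses "Frobenius-isotropic and Frobenius-normalized type" are not even needed for
this conjunct); nothing here bears on [IUTchIII] Cor. 3.12.
-/

namespace Literature.AlgebraicGeometry.Frobenioids

open CategoryTheory Opposite

universe w v v' u u'

namespace PreFrobenioid

variable {D : Type u} [Category.{v} D] {Φ : Dᵒᵖ ⥤ CommMonCat.{w}}
  {C : Type u'} [Category.{v'} C] {F : C ⥤ ElemFrobenioid Φ}

open PreFrobenioidData (ofFunctor)

/-! ### Def. 4.5 (ii) for `C^un-tr`: rational objects -/

/-- **A rational isotropic object of `C` is rational in `C^un-tr`** (Def. 4.5 (ii) at THE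
birationalizations, same support predicate `Supp` on `Φ`): if `A′ → A` is a pull-back morphism of `C` with
`A′` strictly rational and `A` isotropic, then `A′` is isotropic (Prop. 1.9 (iv)), `[A′ → A]` is a pull-back
morphism of `C^un-tr` (Prop. 3.3 (iv)), and `A′` is strictly rational in `C^un-tr` because
`Φ^birat_C(Base A′) ⊆ Φ^birat_{C^un-tr}(Base A′)`. [cite: MochizukiFrdI2008, Def. 4.5 (ii) p.86] -/
theorem isRational_untr_of (hF : IsFrobenioid F)
    (Supp : ∀ {X : D}, (ofFunctor Φ F).Mon X → Primes ((ofFunctor Φ F).Mon X) → Prop)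
    {hsq : HasBiratSquares F} {hsq' : HasBiratSquares (untrFunctor hF)} (A : (ofFunctor Φ F).Untr)
    (h : PreFrobenioidData.IsRational (biratData hF hsq) Supp A.as.obj) :
    PreFrobenioidData.IsRational (biratData (isFrobenioid_untr hF) hsq')
      (S := ofFunctor Φ (untrFunctor hF)) Supp A := by
  obtain ⟨A', φ, hφ, hsr⟩ := h
  have hφ' : IsPullbackMorphism F φ := (PreFrobenioidData.ofFunctor_isPullbackMorphism F φ).mp hφ
  have hA : IsIsotropic F A.as.obj := (PreFrobenioidData.ofFunctor_isIsotropic F A.as.obj).mp A.as.property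
  have hA' : IsIsotropic F A' := (isIsotropic_iff_of_isPullbackMorphism hF φ hφ').mpr hA
  let A'' : (ofFunctor Φ F).Istr := ⟨A', isIsotropic_data_of hA'⟩
  let a : A'' ⟶ A.as := ObjectProperty.homMk φ
  refine ⟨(ofFunctor Φ F).toUntr.obj A'', (ofFunctor Φ F).toUntr.map a,
    (PreFrobenioidData.ofFunctor_isPullbackMorphism _ _).mpr (isPullbackMorphism_toUntr_of hF a hφ'), fun 𝔭 => ?_⟩
  obtain ⟨x, y, hxy, hx, hy⟩ := hsr 𝔭
  exact ⟨x, y, biratSubgroup_le_untr hF _ hxy, hx, hy⟩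

end PreFrobenioid

/-! ### Proposition 5.5 (iii), "Finally": the `C^un-tr` conjunct of the rationally-standard clause -/

namespace FrdI.Prop55Sub

open PreFrobenioid PreFrobenioidData

variable {D : Type u} [Category.{v} D] {Φ : Dᵒᵖ ⥤ CommMonCat.{w}}
  {C : Type u'} [Category.{v'} C] (F : C ⥤ ElemFrobenioid Φ)

/-- **Proposition 5.5 (iii), "Finally", rationally standard type — the `C^un-tr` conjunct (PROVED)**:
for a Frobenioid `C → F_Φ` that is NOT of group-like type, if `C` is of rationally standard type over THE
parameters `rsParams hF Supp` (THE birationalization `C^birat`, a support predicate `Supp` on `Φ`, THE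
unit-trivialisation `C^un-tr → F_Φ` and ITS birationalization), then so is `C^un-tr` over ITS parameters
`rsParams (isFrobenioid_untr hF) Supp` — Def. 4.5 (iii) clause by clause: standard (w4-d084),
birationally Frobenius-normalized (Thm. 5.1 (iv) for the isotropic unit-trivial Frobenioid `C^un-tr`),
rational (`isRational_untr_of`), and a Frobenius-compact object of `((C^un-tr)^un-tr)^birat`
(`Birat.exists_isFrobeniusCompact_untrBirat_of`). This is the `C^un-tr` half of the named slot
`Prop55iii_untr_rlf_ratStd` (whose `C^rlf` half is GAP row P55iii-F1).
[cite: MochizukiFrdI2008, Prop. 5.5 (iii) p.104] -/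
theorem prop55iii_untr_ratStd_of (hF : IsFrobenioid F)
    (Supp : ∀ {X : D}, (PreFrobenioidData.ofFunctor Φ F).Mon X →
      Primes ((PreFrobenioidData.ofFunctor Φ F).Mon X) → Prop)
    (hng : ¬ IsOfType (IsGroupLikeObj F))
    (h : (PreFrobenioidData.ofFunctor Φ F).IsOfRationallyStandardType (rsParams hF Supp)) :
    (PreFrobenioidData.ofFunctor Φ (untrFunctor hF)).IsOfRationallyStandardType
      (rsParams (isFrobenioid_untr hF) Supp) where
  biratFrobNormalized :=
    isOfBiratFrobeniusNormalizedType_biratData_of_isOfUnitTrivialType (isFrobenioid_untr hF) _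
      (isOfIsotropicType_untr hF) (isOfUnitTrivialType_untr hF)
  rational A := isRational_untr_of hF Supp A (h.rational A.as.obj)
  standard := isOfStandardType_untr' hF hng h.standard
  frobCompact :=
    Birat.exists_isFrobeniusCompact_untrBirat_of (isFrobenioid_untr hF) (hasBiratSquares_untr hF)
      (isOfIsotropicType_untr hF) (isOfUnitTrivialType_untr hF) h.frobCompact

/-- The same under the printed standing hypotheses of Prop. 5.5 ("`C` of Frobenius-isotropic and
Frobenius-normalized type"; not used) — literally the `C^un-tr` conjunct of the named statement
`Prop55iii_untr_rlf_ratStd hF hΦ Supp SuppR` for every `hΦ`, `SuppR`.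
[cite: MochizukiFrdI2008, Prop. 5.5 (iii) p.104] -/
theorem prop55iii_untr_ratStd_of' (hF : IsFrobenioid F)
    (Supp : ∀ {X : D}, (PreFrobenioidData.ofFunctor Φ F).Mon X →
      Primes ((PreFrobenioidData.ofFunctor Φ F).Mon X) → Prop)
    (_hiso : IsOfType (IsFrobeniusIsotropic F)) (_hnorm : IsOfType (IsFrobeniusNormalized F))
    (hng : ¬ IsOfType (IsGroupLikeObj F))
    (h : (PreFrobenioidData.ofFunctor Φ F).IsOfRationallyStandardType (rsParams hF Supp)) :
    (PreFrobenioidData.ofFunctor Φ (untrFunctor hF)).IsOfRationallyStandardType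
      (rsParams (isFrobenioid_untr hF) Supp) :=
  prop55iii_untr_ratStd_of F hF Supp hng h

end FrdI.Prop55Sub

end Literature.AlgebraicGeometry.Frobenioids
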